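import Summits.CriticalPhenomena.PercolationContinuityZ3.Theorems.PercNearOneGluingNoHeavyLowerTailSahiE3CertificateObstruction
import Mathlib.Tactic.Linarith
import Mathlib.Tactic.Ring
import Mathlib.Tactic.NormNum
import HarnessLib
import HarnessLib.Audit

/-!
# `NoHeavyLowerTail` (crux stmt-CriticalPhenomena-4575), Sahi programme P4: the flow-certificate method FAILS for the read-once
# CNF `(x₁∨x₂)∧(x₃∨x₄)∧…∧(x₁₁∨x₁₂)` under the uniform measure (COMPUTATIONAL instance of `…SahiE3CertificateObstruction`)

Support file (cell `prim-l12`, seat P4, generation 12; `--supports stmt-CriticalPhenomena-4575`, computational: the three numeric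
hypotheses of `…SahiE3CertificateObstruction.no_certificate_of_pinnedFamily` are integer identities / inequalities over the
`4⁶ = 4096`-point pattern, evaluated by `native_decide` in `cnf_six_pin`, `cnf_six_sign`, `cnf_six_neg`).  No named facts, no sorries, def-free.

THEOREM `no_certificate_cnf_six`.  Pattern `P = Fin 6 → Bool × Bool` (clause `i` = the pair of variables `(t i).1, (t i).2`,
componentwise order), uniform masses `ν ≡ 1` (Bernoulli(½), homogeneous normalisation `Z = 4096`), slot
`U = {t | ∀ i, t i ≠ (false,false)}` = the monotone read-once CNF `∧ᵢ ((t i).1 ∨ (t i).2)` (`N_U = 3⁶ = 729`).  Then NO flow certificate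
`(R, F)` ((R0), (F0), (F≤), (cap), (K), (pair) of `…SahiE3PatternCertificate.phi_nonneg_of_patternCertificate`) exists.
Pinned family: `S_B = {t | ∀ i ∈ B, (t i).1}`, `T_B = {t | ∀ i ∈ B, (t i).2}` (`B ⊆ Fin 6`), coefficients `(−1)^{|B|}`; the signed sum
of the pinned values is `Σ_B (−1)^{|B|}(2²⁵·3^{6−|B|} − 3⁶·2^{24−2|B|}) = 2³¹ − 3¹²·2¹² = −29 298 688 < 0` (HOME
prim-l12-p4/FROM-prim-l12-p4-gen12-CERTIFICATE-OBSTRUCTION.md §1; general `m, p`: no certificate iff-direction whenever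
`((2−p)(1+p)/2)^m > 2`).  Consequence: the kernel-certificate route of generations 6–11 cannot prove Sahi's `C₃` / Kahn's Conjecture 5
for every read-once first slot; the crossing-family inequality MIX of generation 11 is false on `(2¹², uniform, CNF₆)`.
-/

namespace Summit.CriticalPhenomena.PercolationContinuityZ3.Theorems.SahiE3CertificateObstructionCNF

open Finset SahiE3CertificateObstruction
open scoped BigOperators

/-- The literal-cylinders `{t | ∀ i ∈ B, (t i).1 = true}` are up-sets of `Fin 6 → Bool × Bool`. [this work] -/
theorem isUpperSet_fst (B : Finset (Fin 6)) :
    IsUpperSet ((univ.filter fun t : Fin 6 → Bool × Bool => ∀ i ∈ B, (t i).1 = true : Finset _) : Set (Fin 6 → Bool × Bool)) := by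
  intro a b hab ha
  simp only [Finset.coe_filter, Finset.mem_univ, true_and, Set.mem_setOf_eq] at ha ⊢
  intro i hi
  have h1 : (a i).1 ≤ (b i).1 := (Prod.le_def.1 (hab i)).1
  rw [ha i hi] at h1
  exact top_le_iff.mp h1

/-- The literal-cylinders `{t | ∀ i ∈ B, (t i).2 = true}` are up-sets of `Fin 6 → Bool × Bool`. [this work] -/
theorem isUpperSet_snd (B : Finset (Fin 6)) :
    IsUpperSet ((univ.filter fun t : Fin 6 → Bool × Bool => ∀ i ∈ B, (t i).2 = true : Finset _) : Set (Fin 6 → Bool × Bool)) := by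
  intro a b hab ha
  simp only [Finset.coe_filter, Finset.mem_univ, true_and, Set.mem_setOf_eq] at ha ⊢
  intro i hi
  have h1 : (a i).2 ≤ (b i).2 := (Prod.le_def.1 (hab i)).2
  rw [ha i hi] at h1
  exact top_le_iff.mp h1

/-- Pinning of the 64 literal-cylinder pairs: `need(S_B,T_B) = Z(Z+N_D)|S_B∩T_B∩U| − Z·N_U·|S_B∩T_B∩Uᶜ|` in counts
(`Z = 4096`, `N_U = 729`, `N_D = 3367`), evaluated by `native_decide` (computational). [this work] -/
theorem cnf_six_pin : ∀ B : Finset (Fin 6),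
      (4096 : ℤ) * (((univ.filter fun t : Fin 6 → Bool × Bool => ∀ i ∈ B, (t i).1 = true).card : ℤ)
            * ((univ.filter fun t : Fin 6 → Bool × Bool => (∀ i ∈ B, (t i).2 = true) ∧ ∀ i, t i ≠ (false, false)).card : ℤ)
          + ((univ.filter fun t : Fin 6 → Bool × Bool => ∀ i ∈ B, (t i).2 = true).card : ℤ)
            * ((univ.filter fun t : Fin 6 → Bool × Bool => (∀ i ∈ B, (t i).1 = true) ∧ ∀ i, t i ≠ (false, false)).card : ℤ))
        - 729 * ((univ.filter fun t : Fin 6 → Bool × Bool => ∀ i ∈ B, (t i).1 = true).card : ℤ)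
            * ((univ.filter fun t : Fin 6 → Bool × Bool => ∀ i ∈ B, (t i).2 = true).card : ℤ)
      = 4096 * (4096 + 3367)
          * ((univ.filter fun t : Fin 6 → Bool × Bool =>
              ((∀ i ∈ B, (t i).1 = true) ∧ ∀ i ∈ B, (t i).2 = true) ∧ ∀ i, t i ≠ (false, false)).card : ℤ)
        - 4096 * 729
          * ((univ.filter fun t : Fin 6 → Bool × Bool =>
              ((∀ i ∈ B, (t i).1 = true) ∧ ∀ i ∈ B, (t i).2 = true) ∧ ¬ ∀ i, t i ≠ (false, false)).card : ℤ) := by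
  native_decide

/-- Möbius sign condition: `Σ_B (−1)^{|B|} 1[t ∈ S_B ∩ T_B] ≥ 0` for every point (it equals `1` if no clause of `t` is `(true,true)`,
else `0`), evaluated by `native_decide` (computational). [this work] -/
theorem cnf_six_sign : ∀ t : Fin 6 → Bool × Bool,
      0 ≤ ∑ B : Finset (Fin 6), (-1 : ℤ) ^ B.card *
        (if (∀ i ∈ B, (t i).1 = true) ∧ ∀ i ∈ B, (t i).2 = true then 1 else 0) := by
  native_decide

/-- The signed sum of the pinned values is negative: `Σ_B (−1)^{|B|} need(S_B,T_B) = 2³¹ − 3¹²·2¹² = −29 298 688 < 0`,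
evaluated by `native_decide` (computational). [this work] -/
theorem cnf_six_neg : ∑ B : Finset (Fin 6), (-1 : ℤ) ^ B.card *
      ((4096 : ℤ) * (((univ.filter fun t : Fin 6 → Bool × Bool => ∀ i ∈ B, (t i).1 = true).card : ℤ)
            * ((univ.filter fun t : Fin 6 → Bool × Bool => (∀ i ∈ B, (t i).2 = true) ∧ ∀ i, t i ≠ (false, false)).card : ℤ)
          + ((univ.filter fun t : Fin 6 → Bool × Bool => ∀ i ∈ B, (t i).2 = true).card : ℤ)
            * ((univ.filter fun t : Fin 6 → Bool × Bool => (∀ i ∈ B, (t i).1 = true) ∧ ∀ i, t i ≠ (false, false)).card : ℤ))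
        - 729 * ((univ.filter fun t : Fin 6 → Bool × Bool => ∀ i ∈ B, (t i).1 = true).card : ℤ)
            * ((univ.filter fun t : Fin 6 → Bool × Bool => ∀ i ∈ B, (t i).2 = true).card : ℤ)) < 0 := by
  native_decide

/-- `|P| = 4⁶ = 4096` (computational). [this work] -/
theorem cnf_six_card_univ : (univ : Finset (Fin 6 → Bool × Bool)).card = 4096 := by
  native_decide

/-- `|U| = 3⁶ = 729` (computational). [this work] -/
theorem cnf_six_card_slot : (univ.filter fun t : Fin 6 → Bool × Bool => ∀ i, t i ≠ (false, false)).card = 729 := by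
  native_decide

/-- `|Uᶜ| = 4096 − 729 = 3367` (computational). [this work] -/
theorem cnf_six_card_compl : (univ.filter fun t : Fin 6 → Bool × Bool => ¬ ∀ i, t i ≠ (false, false)).card = 3367 := by
  native_decide

/-- **No flow certificate for the read-once CNF `(x₁∨x₂)∧…∧(x₁₁∨x₁₂)` under the uniform measure.**  With
`P = Fin 6 → Bool × Bool`, `ν ≡ 1` and `U = {t | ∀ i, t i ≠ (false,false)}`, there are no `R, F` satisfying the six certificate
conditions of `…SahiE3PatternCertificate.phi_nonneg_of_patternCertificate`.  Proof: `no_certificate_of_pinnedFamily` with the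
64 literal-cylinder pairs and Möbius signs; numerics `cnf_six_pin`, `cnf_six_sign`, `cnf_six_neg`. [this work] -/
theorem no_certificate_cnf_six (U : Finset (Fin 6 → Bool × Bool)) (hU : ∀ t, t ∈ U ↔ ∀ i, t i ≠ (false, false)) :
    ¬ ∃ (R : (Fin 6 → Bool × Bool) → ℝ) (F : (Fin 6 → Bool × Bool) → (Fin 6 → Bool × Bool) → ℝ),
      (∀ t ∈ U, 0 ≤ R t) ∧ (∀ t s, 0 ≤ F t s) ∧ (∀ t s, F t s ≠ 0 → s ≤ t) ∧
      (∀ t ∈ U, R t + ∑ s ∈ Uᶜ, F t s ≤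
        (∑ _r : Fin 6 → Bool × Bool, (1 : ℝ)) * ((∑ _r : Fin 6 → Bool × Bool, (1 : ℝ)) + ∑ _r ∈ Uᶜ, (1 : ℝ)) * 1) ∧
      (∀ s ∈ Uᶜ, (∑ _r : Fin 6 → Bool × Bool, (1 : ℝ)) * (∑ _r ∈ U, (1 : ℝ)) * 1 ≤ ∑ t ∈ U, F t s) ∧
      (∀ S S' : Finset (Fin 6 → Bool × Bool), IsUpperSet (S : Set (Fin 6 → Bool × Bool)) →
        IsUpperSet (S' : Set (Fin 6 → Bool × Bool)) →
        (∑ _r : Fin 6 → Bool × Bool, (1 : ℝ)) * ((∑ _t ∈ S, (1 : ℝ)) * (∑ _t ∈ S' ∩ U, (1 : ℝ))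
            + (∑ _t ∈ S', (1 : ℝ)) * (∑ _t ∈ S ∩ U, (1 : ℝ)))
            - (∑ _r ∈ U, (1 : ℝ)) * (∑ _t ∈ S, (1 : ℝ)) * (∑ _t ∈ S', (1 : ℝ))
          ≤ ∑ t ∈ (S ∩ S') ∩ U, R t
            + ∑ s ∈ (S ∩ S') ∩ Uᶜ, (∑ t ∈ U, F t s - (∑ _r : Fin 6 → Bool × Bool, (1 : ℝ)) * (∑ _r ∈ U, (1 : ℝ)) * 1)) := by
  have hUe : U = univ.filter fun t : Fin 6 → Bool × Bool => ∀ i, t i ≠ (false, false) := by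
    ext t; simp [hU]
  have hpin := cnf_six_pin; have hc := cnf_six_sign; have hneg := cnf_six_neg
  have cZ := cnf_six_card_univ; have cU := cnf_six_card_slot; have cD := cnf_six_card_compl
  have key := no_certificate_of_pinnedFamily (P := Fin 6 → Bool × Bool) U (fun _ => (1 : ℝ)) (ι := Finset (Fin 6)) univ
    (fun B => univ.filter fun t : Fin 6 → Bool × Bool => ∀ i ∈ B, (t i).1 = true)
    (fun B => univ.filter fun t : Fin 6 → Bool × Bool => ∀ i ∈ B, (t i).2 = true)
    (fun B => (-1 : ℝ) ^ B.card) (fun B _ => isUpperSet_fst B) (fun B _ => isUpperSet_snd B)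
  simp only [Finset.sum_const, nsmul_eq_mul, mul_one] at key ⊢
  -- rewrite all intersections / complements as single filters and insert the cardinalities
  have hUc : Uᶜ = univ.filter fun t : Fin 6 → Bool × Bool => ¬ ∀ i, t i ≠ (false, false) := by
    rw [hUe, Finset.compl_filter]
  have iTU : ∀ B : Finset (Fin 6), (univ.filter fun t : Fin 6 → Bool × Bool => ∀ i ∈ B, (t i).2 = true) ∩ U =
      univ.filter fun t => (∀ i ∈ B, (t i).2 = true) ∧ ∀ i, t i ≠ (false, false) := by
    intro B; rw [hUe, ← Finset.filter_and]
  have iSU : ∀ B : Finset (Fin 6), (univ.filter fun t : Fin 6 → Bool × Bool => ∀ i ∈ B, (t i).1 = true) ∩ U =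
      univ.filter fun t => (∀ i ∈ B, (t i).1 = true) ∧ ∀ i, t i ≠ (false, false) := by
    intro B; rw [hUe, ← Finset.filter_and]
  have iSTU : ∀ B : Finset (Fin 6), (univ.filter fun t : Fin 6 → Bool × Bool => ∀ i ∈ B, (t i).1 = true) ∩
      (univ.filter fun t : Fin 6 → Bool × Bool => ∀ i ∈ B, (t i).2 = true) ∩ U =
      univ.filter fun t => ((∀ i ∈ B, (t i).1 = true) ∧ ∀ i ∈ B, (t i).2 = true) ∧ ∀ i, t i ≠ (false, false) := by
    intro B; rw [hUe, ← Finset.filter_and, ← Finset.filter_and]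
  have iSTD : ∀ B : Finset (Fin 6), (univ.filter fun t : Fin 6 → Bool × Bool => ∀ i ∈ B, (t i).1 = true) ∩
      (univ.filter fun t : Fin 6 → Bool × Bool => ∀ i ∈ B, (t i).2 = true) ∩ Uᶜ =
      univ.filter fun t => ((∀ i ∈ B, (t i).1 = true) ∧ ∀ i ∈ B, (t i).2 = true) ∧ ¬ ∀ i, t i ≠ (false, false) := by
    intro B; rw [hUc, ← Finset.filter_and, ← Finset.filter_and]
  have iST : ∀ (B : Finset (Fin 6)) (t : Fin 6 → Bool × Bool),
      (t ∈ (univ.filter fun t : Fin 6 → Bool × Bool => ∀ i ∈ B, (t i).1 = true) ∩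
        (univ.filter fun t : Fin 6 → Bool × Bool => ∀ i ∈ B, (t i).2 = true)) ↔
      ((∀ i ∈ B, (t i).1 = true) ∧ ∀ i ∈ B, (t i).2 = true) := by
    intro B t; simp [Finset.mem_inter, Finset.mem_filter]
  have cZ' : ((univ : Finset (Fin 6 → Bool × Bool)).card : ℝ) = 4096 := by exact_mod_cast cZ
  have cU' : (U.card : ℝ) = 729 := by rw [hUe]; exact_mod_cast cU
  have cD' : (Uᶜ.card : ℝ) = 3367 := by rw [hUc]; exact_mod_cast cD
  rw [cZ', cU', cD'] at key ⊢
  simp only [iTU, iSU, iSTU, iSTD] at key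
  refine key ?_ ?_ ?_
  · intro B _
    have h := hpin B
    exact_mod_cast h
  · intro t
    have h := hc t
    have e : ∀ B : Finset (Fin 6), ((-1 : ℝ) ^ B.card * if t ∈ (univ.filter fun t : Fin 6 → Bool × Bool => ∀ i ∈ B, (t i).1 = true) ∩
        (univ.filter fun t : Fin 6 → Bool × Bool => ∀ i ∈ B, (t i).2 = true) then (1 : ℝ) else 0) =
        (((-1 : ℤ) ^ B.card * if (∀ i ∈ B, (t i).1 = true) ∧ ∀ i ∈ B, (t i).2 = true then (1 : ℤ) else 0 : ℤ) : ℝ) := by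
      intro B
      by_cases hq : ((∀ i ∈ B, (t i).1 = true) ∧ ∀ i ∈ B, (t i).2 = true)
      · have hm := (iST B t).2 hq
        rw [if_pos hm, if_pos hq]; push_cast; ring
      · have hm : ¬ (t ∈ (univ.filter fun t : Fin 6 → Bool × Bool => ∀ i ∈ B, (t i).1 = true) ∩
            (univ.filter fun t : Fin 6 → Bool × Bool => ∀ i ∈ B, (t i).2 = true)) := fun h => hq ((iST B t).1 h)
        rw [if_neg hm, if_neg hq]; push_cast; ring
    rw [Finset.sum_congr rfl fun B _ => e B]
    exact_mod_cast h
  · have h2 := (Int.cast_lt (R := ℝ)).2 hneg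
    push_cast at h2
    linarith [h2]

end Summit.CriticalPhenomena.PercolationContinuityZ3.Theorems.SahiE3CertificateObstructionCNF
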